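import Summits.AtomisticToContinuum.FouriersLaw.Theorems.BondHeatUncertaintySubdiffusiveBondHeatKernelGibbsA

/-!
# Kernel-level Gibbs invariance for the pinned chain, part B: truncated Gibbs densities

Second of four support files proving clause (a) of `BoundaryEscapeDeficit.BoundaryKernelBasics`
(stmt-AtomisticToContinuum-12239) — invariance of the Gibbs measure under the constructed transition kernels at
equal bath temperatures — needed by crux `stmt-AtomisticToContinuum-9120` (`BondHeatUncertainty.SubdiffusiveBondHeat`,
line `bath-bond-deficit-integral`, stub `stub_bathBondReduction`). This part: global bounds on `χ'`, `χ''` for the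
tree's smooth cutoff `smoothCutoff`, the truncation profile `G_R(h) = e^{-h/T} χ(h/R)` with its first two
derivatives, and the key estimate `L̂ (G_R∘H) = -2γ (G_R∘H) + O(1/R)` uniformly on phase space for the generator
`L̂` of the time-reversed Langevin equation (confining `C²` potentials, `N ≥ 1`, `T > 0`).
-/

noncomputable section

open MeasureTheory ProbabilityTheory Filter Topology Set
open scoped NNReal ENNReal

namespace Summit.AtomisticToContinuum.FouriersLaw.Theorems.SubdiffusiveBondHeat

open Literature.MathematicalPhysics.KineticTheory.HeatConduction
open Literature.MathematicalPhysics.KineticTheory Literature.Probability.Process OscillatorChain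

variable {N : ℕ}

/-! ### Bounds on the derivatives of the smooth cutoff -/

section Cutoff

/-- `χ' = 0` off `[1, 2]` (`χ` is locally constant there). [folklore] -/
theorem deriv_smoothCutoff_eq_zero_of_notMem {u : ℝ} (hu : u ∉ Icc (1:ℝ) 2) : deriv smoothCutoff u = 0 := by
  rw [mem_Icc, not_and_or, not_le, not_le] at hu
  rcases hu with hu | hu
  · have h : smoothCutoff =ᶠ[𝓝 u] fun _ => (1:ℝ) := by
      filter_upwards [Iio_mem_nhds hu] with v hv
      exact smoothCutoff_of_le_one (le_of_lt hv)
    rw [h.deriv_eq, deriv_const]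
  · have h : smoothCutoff =ᶠ[𝓝 u] fun _ => (0:ℝ) := by
      filter_upwards [Ioi_mem_nhds hu] with v hv
      exact smoothCutoff_of_two_le (le_of_lt hv)
    rw [h.deriv_eq, deriv_const]

/-- `χ'` has compact support (inside `[1, 2]`). [folklore] -/
theorem hasCompactSupport_deriv_smoothCutoff : HasCompactSupport (deriv smoothCutoff) :=
  HasCompactSupport.intro isCompact_Icc fun _ hu => deriv_smoothCutoff_eq_zero_of_notMem hu

/-- `χ'` is bounded. [folklore] -/
theorem exists_bound_deriv_smoothCutoff : ∃ M : ℝ, 0 ≤ M ∧ ∀ u, |deriv smoothCutoff u| ≤ M := by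
  have hc : Continuous (deriv smoothCutoff) := (contDiff_smoothCutoff (n := 1)).continuous_deriv le_rfl
  obtain ⟨C, hC⟩ := hc.bounded_above_of_compact_support hasCompactSupport_deriv_smoothCutoff
  refine ⟨max C 0, le_max_right _ _, fun u => ?_⟩
  have := hC u
  rw [Real.norm_eq_abs] at this
  exact this.trans (le_max_left _ _)

/-- `χ''` is bounded. [folklore] -/
theorem exists_bound_deriv_deriv_smoothCutoff :
    ∃ M : ℝ, 0 ≤ M ∧ ∀ u, |deriv (deriv smoothCutoff) u| ≤ M := by
  have h1 : ContDiff ℝ 1 (deriv smoothCutoff) := (contDiff_smoothCutoff (n := 2)).deriv'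
  have hc : Continuous (deriv (deriv smoothCutoff)) := h1.continuous_deriv le_rfl
  obtain ⟨C, hC⟩ := hc.bounded_above_of_compact_support hasCompactSupport_deriv_smoothCutoff.deriv
  refine ⟨max C 0, le_max_right _ _, fun u => ?_⟩
  have := hC u
  rw [Real.norm_eq_abs] at this
  exact this.trans (le_max_left _ _)

/-- `χ` is differentiable with derivative `χ'`. [folklore] -/
theorem hasDerivAt_smoothCutoff (u : ℝ) : HasDerivAt smoothCutoff (deriv smoothCutoff u) u :=
  ((contDiff_smoothCutoff (n := 1)).differentiable one_ne_zero u).hasDerivAt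

/-- `χ'` is differentiable with derivative `χ''`. [folklore] -/
theorem hasDerivAt_deriv_smoothCutoff (u : ℝ) :
    HasDerivAt (deriv smoothCutoff) (deriv (deriv smoothCutoff) u) u :=
  (((contDiff_smoothCutoff (n := 2)).deriv' (n := 1)).differentiable one_ne_zero u).hasDerivAt

end Cutoff

/-! ### The truncated Gibbs densities `ρ_R = e^{-H/T} χ(H/R)` -/

section Truncation

/-- The truncation profile `G_R(h) = e^{-h/T} χ(h/R)` of the Gibbs weight. [folklore] -/
theorem hasDerivAt_truncProfile (T R u : ℝ) :
    HasDerivAt (fun h => Real.exp (-h / T) * smoothCutoff (h / R))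
      (-(1 / T) * (Real.exp (-u / T) * smoothCutoff (u / R)) +
        Real.exp (-u / T) * deriv smoothCutoff (u / R) / R) u := by
  have h1 : HasDerivAt (fun h : ℝ => -h / T) (-1 / T) u := by
    simpa using ((hasDerivAt_id u).neg).div_const T
  have h2 : HasDerivAt (fun h => smoothCutoff (h / R)) (deriv smoothCutoff (u / R) / R) u := by
    have hid : HasDerivAt (fun h : ℝ => h / R) (1 / R) u := by simpa using (hasDerivAt_id u).div_const R
    have := (hasDerivAt_smoothCutoff (u / R)).comp u hid
    simp only [Function.comp_def] at this
    exact this.congr_deriv (by ring)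
  exact (h1.exp.mul h2).congr_deriv (by ring)

/-- The second derivative of the truncation profile. [folklore] -/
theorem hasDerivAt_deriv_truncProfile {T R : ℝ} (hT : T ≠ 0) (hR : R ≠ 0) (u : ℝ) :
    HasDerivAt (fun h => -(1 / T) * (Real.exp (-h / T) * smoothCutoff (h / R)) +
        Real.exp (-h / T) * deriv smoothCutoff (h / R) / R)
      ((1 / T ^ 2) * (Real.exp (-u / T) * smoothCutoff (u / R)) -
        (2 / (T * R)) * (Real.exp (-u / T) * deriv smoothCutoff (u / R)) +
        Real.exp (-u / T) * deriv (deriv smoothCutoff) (u / R) / R ^ 2) u := by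
  have h1 : HasDerivAt (fun h : ℝ => -h / T) (-1 / T) u := by
    simpa using ((hasDerivAt_id u).neg).div_const T
  have h2 : HasDerivAt (fun h => deriv smoothCutoff (h / R)) (deriv (deriv smoothCutoff) (u / R) / R) u := by
    have hid : HasDerivAt (fun h : ℝ => h / R) (1 / R) u := by simpa using (hasDerivAt_id u).div_const R
    have := (hasDerivAt_deriv_smoothCutoff (u / R)).comp u hid
    simp only [Function.comp_def] at this
    exact this.congr_deriv (by ring)
  have hA := (hasDerivAt_truncProfile T R u).const_mul (-(1 / T))
  have hB := ((h1.exp.mul h2).div_const R)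
  exact (hA.add hB).congr_deriv (by field_simp; ring)

variable {P : OscillatorChain}

/-- `h e^{-h/T} ≤ T` for `h ≥ 0`, `T > 0`. [folklore] -/
theorem mul_exp_neg_div_le {T : ℝ} (hT : 0 < T) (h : ℝ) : h * Real.exp (-h / T) ≤ T := by
  have h1 : h / T + 1 ≤ Real.exp (h / T) := Real.add_one_le_exp _
  have h2 : 0 < Real.exp (h / T) := Real.exp_pos _
  have h3 : Real.exp (-h / T) = (Real.exp (h / T))⁻¹ := by rw [neg_div, Real.exp_neg]
  rw [h3]
  rw [div_add_one hT.ne', div_le_iff₀ hT] at h1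
  calc h * (Real.exp (h / T))⁻¹ ≤ (Real.exp (h / T) * T) * (Real.exp (h / T))⁻¹ := by
        apply mul_le_mul_of_nonneg_right _ (inv_nonneg.2 h2.le); linarith
    _ = T := by field_simp

/-- **The reversed generator of the truncated Gibbs density**: at equal bath temperatures `T > 0`,
`L̂ ρ_R = -2γ ρ_R + err_R` with `|err_R| ≤ C/R` uniformly on phase space for `R ≥ 1`
(`ρ_R = e^{-H/T}χ(H/R)`; the error collects the `χ'`, `χ''` terms, which carry factors `1/R`, `1/R²` and
`e^{-H/T}(1 + p_0² + p_{N-1}²) ≤ const`). Confining `C²` potentials with `U, V ≥ 0`, `N ≥ 1`. [folklore] -/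
theorem revGenerator_truncGibbs_sub_le (hU : ContDiff ℝ 2 P.U) (hV : ContDiff ℝ 2 P.V)
    (hU0 : ∀ q, 0 ≤ P.U q) (hV0 : ∀ r, 0 ≤ P.V r) (hN : 0 < N) (hγ : 0 ≤ P.γ) {T : ℝ} (hT : 0 < T) :
    ∃ C : ℝ, ∀ R : ℝ, 1 ≤ R → ∀ x : PhaseSpace N,
      |sdeGenerator (fun y => -P.drift N y) (P.bathVecL N T) (P.bathVecR N T)
          (fun y => Real.exp (-P.hamiltonian N y / T) * smoothCutoff (P.hamiltonian N y / R)) x +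
        2 * P.γ * (Real.exp (-P.hamiltonian N x / T) * smoothCutoff (P.hamiltonian N x / R))| ≤ C / R := by
  obtain ⟨M₁, hM₁0, hM₁⟩ := exists_bound_deriv_smoothCutoff
  obtain ⟨M₂, hM₂0, hM₂⟩ := exists_bound_deriv_deriv_smoothCutoff
  refine ⟨P.γ * (M₁ * (2 * T + 4 * T) + M₂ * (T * (4 * T))), fun R hR x => ?_⟩
  have hR0 : 0 < R := lt_of_lt_of_le one_pos hR
  have hTγ : 0 ≤ P.γ * T := mul_nonneg hγ hT.le
  have h := revGenerator_comp_hamiltonian hU hV hN hTγ hTγ (hasDerivAt_truncProfile T R)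
    (hasDerivAt_deriv_truncProfile hT.ne' hR0.ne') x
  rw [h]
  -- notation
  set Hx := P.hamiltonian N x with hHx
  set E := Real.exp (-Hx / T) with hE
  set χ₀ := smoothCutoff (Hx / R)
  set χ₁ := deriv smoothCutoff (Hx / R)
  set χ₂ := deriv (deriv smoothCutoff) (Hx / R)
  set S := x.2 ⟨0, hN⟩ ^ 2 + x.2 ⟨N - 1, Nat.sub_lt hN one_pos⟩ ^ 2 with hS
  have hS0 : 0 ≤ S := by positivity
  have hE0 : 0 < E := Real.exp_pos _
  have hH0 : 0 ≤ Hx := P.hamiltonian_nonneg_of_nonneg hU0 hV0 N x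
  have hE1 : E ≤ 1 := by
    rw [hE, Real.exp_le_one_iff, neg_div]
    exact neg_nonpos.2 (div_nonneg hH0 hT.le)
  -- `S ≤ 4 H` and `E · S ≤ 4T`
  have hSH : S ≤ 4 * Hx := by
    have hk := P.kinetic_le_hamiltonian_of_nonneg hU0 hV0 N x
    have h1 : x.2 ⟨0, hN⟩ ^ 2 / 2 ≤ ∑ i, x.2 i ^ 2 / 2 :=
      Finset.single_le_sum (f := fun i => x.2 i ^ 2 / 2) (fun i _ => by positivity) (Finset.mem_univ _)
    have h2 : x.2 ⟨N - 1, Nat.sub_lt hN one_pos⟩ ^ 2 / 2 ≤ ∑ i, x.2 i ^ 2 / 2 :=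
      Finset.single_le_sum (f := fun i => x.2 i ^ 2 / 2) (fun i _ => by positivity) (Finset.mem_univ _)
    rw [hS]; linarith
  have hES : E * S ≤ 4 * T := by
    have := mul_exp_neg_div_le hT Hx
    calc E * S ≤ E * (4 * Hx) := mul_le_mul_of_nonneg_left hSH hE0.le
      _ = 4 * (Hx * Real.exp (-Hx / T)) := by rw [hE]; ring
      _ ≤ 4 * T := by linarith
  -- the algebraic identity: main term cancels, error = (γ/R)·E·(χ₁ (2T - S) + χ₂ T S / R)
  have key : P.γ * ((-(1 / T) * (E * χ₀) + E * χ₁ / R) * (T + T + x.2 ⟨0, hN⟩ ^ 2 +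
        x.2 ⟨N - 1, Nat.sub_lt hN one_pos⟩ ^ 2) +
      (1 / T ^ 2 * (E * χ₀) - 2 / (T * R) * (E * χ₁) + E * χ₂ / R ^ 2) *
        (T * x.2 ⟨0, hN⟩ ^ 2 + T * x.2 ⟨N - 1, Nat.sub_lt hN one_pos⟩ ^ 2)) + 2 * P.γ * (E * χ₀) =
      P.γ / R * (E * χ₁ * (2 * T - S) + E * S * χ₂ * T / R) := by
    rw [hS]; field_simp; ring
  rw [key, abs_mul, abs_div, abs_of_nonneg hγ, abs_of_pos hR0, div_mul_eq_mul_div]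
  apply div_le_div_of_nonneg_right _ hR0.le
  apply mul_le_mul_of_nonneg_left _ hγ
  have hχ₁ := hM₁ (Hx / R)
  have hχ₂ := hM₂ (Hx / R)
  have t1 : |E * χ₁ * (2 * T - S)| ≤ M₁ * (2 * T + 4 * T) := by
    rw [abs_mul, abs_mul, abs_of_pos hE0]
    have h2TS : |2 * T - S| ≤ 2 * T + S := by
      rw [abs_le]; constructor <;> linarith
    calc E * |χ₁| * |2 * T - S| ≤ E * |χ₁| * (2 * T + S) :=
          mul_le_mul_of_nonneg_left h2TS (by positivity)
      _ = |χ₁| * (E * (2 * T) + E * S) := by ring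
      _ ≤ M₁ * (1 * (2 * T) + 4 * T) := by
          apply mul_le_mul hχ₁ _ (by positivity) hM₁0
          exact add_le_add (mul_le_mul_of_nonneg_right hE1 (by linarith)) hES
      _ = M₁ * (2 * T + 4 * T) := by ring
  have t2 : |E * S * χ₂ * T / R| ≤ M₂ * (T * (4 * T)) := by
    rw [abs_div, abs_of_pos hR0, abs_mul, abs_mul, abs_of_nonneg (mul_nonneg hE0.le hS0), abs_of_pos hT]
    calc E * S * |χ₂| * T / R ≤ E * S * |χ₂| * T / 1 := by
          apply div_le_div_of_nonneg_left _ one_pos hR; positivity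
      _ = |χ₂| * (T * (E * S)) := by ring
      _ ≤ M₂ * (T * (4 * T)) := by
          apply mul_le_mul hχ₂ _ (by positivity) hM₂0
          exact mul_le_mul_of_nonneg_left hES hT.le
  calc |E * χ₁ * (2 * T - S) + E * S * χ₂ * T / R|
      ≤ |E * χ₁ * (2 * T - S)| + |E * S * χ₂ * T / R| := abs_add_le _ _
    _ ≤ M₁ * (2 * T + 4 * T) + M₂ * (T * (4 * T)) := add_le_add t1 t2

end Truncation

end Summit.AtomisticToContinuum.FouriersLaw.Theorems.SubdiffusiveBondHeat

end
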